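import Literature.MathematicalPhysics.QuantumFieldTheory.Balaban1983to89.Node00.Record12
import Literature.MathematicalPhysics.QuantumFieldTheory.Balaban1983to89.B14NodeKnitTowerDatum

/-!
# `Balaban1983to89.B14NodeKnitRecord12R` — YM-DAG node N11 · [Balaban1988Convergent] CMP **119** (1988) 243–285, Theorem 1 p. 262 (with the Theorem
# of p. 245 and the ASSUMED operation 𝐑 of p. 244) AT NODE 00's STAGE-12 RECORD `Node00.IsRecordOfRecord₁₂C`, IN [III]'s OWN DENSITY-LEVEL CURRENCY
# (`B14.RAssumedP244`, `B14.ThmP245PrintedI`, the induction `B14.inductiveAssumptions_of_thmP245`), 𝐑 DISPLAYED EXACTLY AS PRINT ASSUMES IT —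
# the «relative to 𝐑» closer RE-KEYED AT STAGE 12, WHERE THE START IS A THEOREM: Theorem 1 at the objects of record from the p. 244 assumption + the
# Theorem of p. 245, and NOTHING ELSE (no start slot)

statement-level bookkeeping over published theorems with citation tags; kernel-checked compositions of tree theorems;
nothing here is a claim about the Yang–Mills mass gap.

CITATION HEADER (lean-in-tree rule).  Source: T. Bałaban, *Convergent renormalization expansions for lattice gauge theories*, Commun. Math. Phys. **119**,
243–285 (1988), doi:10.1007/bf01217741 [Balaban1988Convergent] (cell paper B14 = «[III]» of [Balaban1989LargeFieldI] ∕ [Balaban1989LargeFieldII]): p. 244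
(𝐑 assumed), the Theorem of p. 245, (2.18) p. 257, Thm 1 and the remarks p. 262, (3.25) p. 270.  Seat `pub-ymgap-dag-n11-e` (YM-PLAN Track A, HUMAN RULING
D-0062; director-ym R134 fan-out row N11∕s3 «`ThmP245Printed` via `rOperation` from N13's `ROpLeaf`»; dag-lead FAN-OUT v1.1 §N11 s3 «PRINT-FAITHFUL 𝐑-AS-HYPOTHESIS»;
director-ym LINE №81 (3) «every Stage-11 module re-instantiates at `Record12`»).  THIS IS THE STAGE-12 TWIN of `…B14NodeKnitRecord11R` (same seat; that module
stays as landed: its §1–§2 are live dictionaries at Stage 11, its §3–§4 are VACUOUS there — see WHAT CHANGED).  BY NAME and UNCHANGED: `…Node00.Record12`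
(seat node00-def-T: `Stage12Params`, `Provisos₁₂`, `VOfRecord₁₂`, `SLaw₁₂`, `TLaw₁₂`, `sLaw₁₂_iff`, **`sLaw₁₂_zero`**, `rOpLeaf_VOfRecord₁₂_iff`, `coreOfRecord₁₂`,
`towerOfRecord₁₂`, `datumOfRecord₁₂`, `upOfRecord₅C … (θ.toStage5₁₂ F N)`, `IsRecordOfRecord₁₂C`, `HasSect2FormAEZ`), `…Node00.Record10` (`densOfRecord₁₀`,
`tdensOfRecord₁₀`), `…B14` (the cell's typed skeleton of [III]: `RAssumedP244` — p. 244 verbatim —, `ThmP245Printed` ∕ `ThmP245PrintedI` ∕ `ThmP245SpacesI` — the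
Theorem of p. 245 verbatim, sequence and space readings —, `inductiveAssumptions_of_thmP245` — Thm 1 ⇐ start + p. 245 Theorem + assumed 𝐑 along (0.2)),
`…DagBinding` (`ROpLeaf` = `B14.RAssumedP244 V.R V.Scorr V.S V.K` BY DEFINITION, `rOpLeaf_iff`, `leavesP`, `WorldP`), `…B14NodeKnitTowerDatum` (seat dag-n11-a:
`b14_main_at_datumOfTower_of_propTower`, `densitiesDescribed_iff_core`), `…Dag` (`B14_main` :224).

THE NODE (Dag.lean :224): `B14_main ℓ := ℓ.b7 → ℓ.b8 → ℓ.b9 → ℓ.b10 → ℓ.b11 → (ℓ.smallCouplings → ℓ.smallFieldInductive) → (ℓ.smallCouplings → ℓ.flowControl) →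
(ℓ.rOperation → (ℓ.smallCouplings → ℓ.densitiesDescribed))`.  𝐑 is an ANTECEDENT of N11 (print, p. 244 [PDF 2], verbatim: *«The operation 𝐑 serves this
purpose. We will not describe it here, we will only assume that it has some properties incorporated in the inductive description of the effective actions.»*);
node N13 ([Balaban1989LargeFieldII] Thm 1) PRODUCES it.  At a Stage-12 record the antecedent `(leavesP w P).rOperation` IS, by the C-binding of record over the
Stage-12 view, the leaf `DagBinding.ROpLeaf (Node00.VOfRecord₁₂ F N θ P)` (§1, `Iff.rfl`) — THE JUNCTION PROP WITH N13 BY NAME (the seat dag-n13-c lineage inhabits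
it; this file consumes it) —, and that leaf IS `B14.RAssumedP244 (VOfRecord₁₂ …).R (VOfRecord₁₂ …).Scorr (VOfRecord₁₂ …).S P.K`, [III]'s own typing of the p. 244
sentence, at the 𝐑-carriers of record (§1, `Iff.rfl`).

WHAT CHANGED AT STAGE 12 (why this twin exists; all three located in the cell and repaired by node00-def-T in `Record12`).  (a) THE START IS A THEOREM: at Stage 11
the level-0 background map of record read no configuration, so the (S0) slot «`ρ₀` of record has the §2 form at index 0» (`SLaw₁₁ θ P 0`) was UNSATISFIABLE at
every windowed run (`B16Thm1BaseAtRecord11.not_sLaw₁₁_zero`; seats dag-n13-e, dag-n11-d, this seat); at Stage 12 the map is the print's `U₀(𝐖) = 𝐖 0` and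
`Node00.sLaw₁₂_zero : SLaw₁₂ F N θ p 0` holds for EVERY `θ`, `p` — so Theorem 1 relative to 𝐑 needs NO start hypothesis: the `h0` binders of the Stage-11 module are
GONE from §3–§4 below (discharged by name, not dropped).  (b) THE §2 FORMAT PREDICATE IS THE REPAIRED ONE (`HasSect2FormAEZ`: each slot of record is absent — the
zero function — or has the (2.18) form a.e. on its χ-support; seat dag-n13-c's located over-demand at absent sequences), so the p. 244 leaf
`∀ k < K, TLaw₁₂ k → SLaw₁₂ (k+1)` is contentful beyond the «𝐑 = 1» branch.  (c) THE PROVISOS ARE INHABITABLE: `Provisos₁₁` was uninhabited (`Node00.not_provisos₁₁`: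
an all-runs radii field reading `0 < 0` at the junk run), so every Stage-11 theorem under `(h : θ.Provisos₁₁)` was vacuous; `Provisos₁₂` drops that field (radii
positivity is a theorem in the window) and window-guards the background proviso.  The Stage-12 𝐓-weights are moreover PINNED per run (`WtOfRecord₁₂`), no longer
a free binder.  Director-ym LINE №92 (2) TYPING DIRECTIVE observed: the 𝐓-step law «`SLaw₁₂ k → TLaw₁₂ k`» (N11's product) appears below ONLY as the displayed
hypothesis `hT`, never as a bare ∀ over records.

WHY THIS FILE (what s3 adds next to s1∕s2 at Stage 12).  The seat-dag-n11-a ∕ -c ∕ -d lineage (`B14NodeKnitTowerDatum` → `…Record9` → the Stage-12 consumer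
`Summits/…/BalabanUVNodesN11AtRecord12C`) states N11 in SLOT currency (laws of the (2.18) slot families, 𝐓-step ∕ 𝐑-step of record) and DISCHARGES the (𝐑)
antecedent's READING by the pin `rOperation_upOfRecord₅C_stage12_iff` (the leaf unfolded into law transport `TLaw₁₂ k → SLaw₁₂ (k+1)`).  Here nothing is
unfolded inside a statement: 𝐑 stays the Prop print assumes — `RAssumedP244` at the carriers of record ∕ `ROpLeaf (VOfRecord₁₂ …)` — displayed as a HYPOTHESIS of
the Theorem-1 closer (§3: no world, no binding, only the objects of record `θ`, `P`), and, at the node, CONSUMED FROM N11's OWN ANTECEDENT through that Prop by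
name (§4: load-bearing, not discarded, not re-derived).  §2 identifies [III]'s sentences at the objects of record: the Theorem of p. 245 (sequence reading along
the trajectory of record, `𝐓ρ_k :=` the 𝐓-image of record `tdensOfRecord₁₀`; [III]'s own slot name `B14.ThmP245PrintedI T ρ S Scorr K` for ANY transformation
family `T` agreeing with the tower on the trajectory; AND the SPACE reading `B14.ThmP245SpacesI` of p. 262's second remark, which at the carriers of record —
whose index-`k` space is `{ρ_k}` cut by the law — COINCIDES with the sequence reading) ↔ `∀ k < K, SLaw₁₂ k → TLaw₁₂ k`; the p. 244 assumption ↔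
`∀ k < K, TLaw₁₂ k → SLaw₁₂ (k+1)` (node00-def-T's `rOpLeaf_VOfRecord₁₂_iff`, quoted); Thm 1's conclusion `densitiesDescribed` at a bound world ↔ `∀ k ≤ K, SLaw₁₂ k`
(n11-a's `densitiesDescribed_iff_core` at the Stage-12 core; the `₁₂`-named unfolding is the s2 seat's, see OWNERSHIP).

WHAT THIS FILE PROVES (0 `sorry`, 0 `def`, standard axioms; every ingredient BY NAME).
§1 `rOperation_iff_rOpLeaf₁₂` · `rOpLeaf₁₂_iff_rAssumedP244` (both `Iff.rfl` after the binding equation) · `rOpLeaf₁₂_of_b16_main` (the producer's side: node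
   N13's statement at a Stage-12-bound run, with its in-edges, YIELDS the leaf at the carriers of record — the Prop the dag-n13-c lineage inhabits, by name).
§2 `thmP245_at_record₁₂_iff_laws` · `thmP245PrintedI_at_record₁₂_iff_laws` · `thmP245SpacesI_at_record₁₂_iff_laws` · `rAssumedP244_at_record₁₂_iff_laws`.
§3 **`sLaw₁₂_all_of_rAssumedP244`** — THEOREM 1 [III] AT THE OBJECTS OF RECORD, RELATIVE TO 𝐑, NO START SLOT: `RAssumedP244` at `VOfRecord₁₂ θ P` + (∀ k < K,
   `SLaw₁₂ θ P k → TLaw₁₂ θ P k`) ⊢ `∀ k ≤ K, SLaw₁₂ θ P k` (the induction of `B14.inductiveAssumptions_of_thmP245`, re-run at the laws of record with the base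
   `Node00.sLaw₁₂_zero`); `hasSect2FormAEZ_all_of_rAssumedP244` (what that SAYS: every `ρ_k`'s slot family has the repaired §2 form at the 𝐓-weights of record);
   `densitiesDescribed_at_record₁₂_of_rOpLeaf` (at a bound world, from the JUNCTION PROP `ROpLeaf (VOfRecord₁₂ θ P)` by name — what an inhabitation theorem
   of the leaf by the N13 lineage plugs into).
§4 **`b14_main_at_record₁₂_of_rOpLeaf`** (THE NODE at any world bound to the datum of record whose `rOperation` antecedent names the leaf — 𝐑 consumed from its
   own antecedent through `ROpLeaf (VOfRecord₁₂ …)`; ONE displayed slot (S1ᵀ), the start discharged), `sLaw₁₂_all_of_b14_main_of_rOpLeaf` (A4 locator: what N11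
   SAYS at Stage 12 given its antecedents, the 𝐑 one AS PRINT ASSUMES IT), **`sLaw₁₂_all_of_b16_main_of_slots`** (Thm 1 at a Stage-12-bound run from node N13's
   statement — which yields the leaf, §1 — N11's ONE printed slot (S1ᵀ) and the remaining antecedents: the N11∕N13 junction BY NAME, as
   `Dag.uv_stability_of_series` composes it).
§5 **`thm1Printed_datumOfRecord₁₂_of_thmP245I_rAssumedP244`** — [V]∕[III] THEOREM 1 AS THE TREE STATES IT (`B16.Thm1Printed (datumOfRecord₁₂ F N θ h).C`, the
   first conjunct of the route's (B)-face `B16.EndStatementBPrinted`) FROM [III]'s TWO SENTENCES IN [III]'s CURRENCY along the windowed runs: the Theorem of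
   p. 245 (`B14.ThmP245PrintedI` at the objects of record, any agreeing `T`-family — or T-free, `thm1Printed_datumOfRecord₁₂_of_laws_rAssumedP244`) and the p. 244
   assumption (`B14.RAssumedP244` at `VOfRecord₁₂`) — node00-def-T's `thm1Printed_datumOfRecord₁₂_of_tLaw_rOpLeaf` READ THROUGH §1–§2 (base a theorem there too).
§6 `densitiesDescribed_of_isRecordOfRecord₁₂C_of_rOperation` — the (D, w)-face of §3 (KEYED on `IsRecordOfRecord₁₂C`): at every run of a Stage-12 record,
   the world's own `rOperation` antecedent + the Theorem of p. 245 at the presenting objects of record ⊢ N11's conclusion leaf `densitiesDescribed`.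
OWNERSHIP (dedup, one public name per object).  The `hup`-keyed node statement `b14_main_at_record₁₂`, the unfoldings `rOperation_iff_laws₁₂` ∕
`densitiesDescribed_iff_sLaw₁₂` ∕ `b14_main_iff_at_record₁₂`, the no-world Theorem-1 readers `sLaw₁₂_all_of_tLaw` (law transport) ∕ `sLaw₁₂_all_of_rOpLeaf`
(from the junction Prop — the one-line consumer an inhabitation theorem of the leaf plugs into), the keyed forms
`b14_main_of_isRecordOfRecord₁₂C` and the route stubs `s_N11_of_refines₁₂C` ∕ `s_N11_rec₁₂C` are seat dag-n11-d's
`Summits/QuantumFields/YangMills/Theorems/BalabanUVNodesN11AtRecord12C.lean` (slot∕law-transport currency; pub-ymgap INBOX l.12786 ∕ l.13017, p459309); they are NOT restated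
here (this Literature module cannot import them; where a proof needs the unfolding it quotes n11-a's `B14NodeKnitTowerDatum.densitiesDescribed_iff_core`).
[V] Theorem 1 at the datum from the LAW-level pieces (`thm1Printed_datumOfRecord₁₂_of_tLaw_rOpLeaf`, `thm1Printed_of_isRecordOfRecord₁₂C_of_tLaw`) is
node00-def-T's `Record12` §5b∕§6 — quoted in §5, not restated.

HONEST FRAMING.  A count-neutral SLOT landing (R429 (4)(i)): N11 is NOT discharged here.  (S1ᵀ) — the Theorem of p. 245 at the objects of record, i.e. Sects. 1–3
of [Balaban1988Convergent] (with Thm 2 p. 263 for `k ≥ 1`) for the repaired §2 form `HasSect2FormAEZ` ∕ 𝐓-image form `HasSect2FormTAEZ` of the slot families of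
record at the 𝐓-weights of record — is a DISPLAYED HYPOTHESIS; 𝐑 is the printed ASSUMPTION of p. 244 (node N13's product; [Balaban1989LargeFieldII] Thm 1),
displayed, never discharged; `(h : θ.Provisos₁₂ F N)` (where a datum is needed) is the K0′-type content of the record, displayed.  The (S0) start is NOT a
hypothesis: it is node00-def-T's theorem `sLaw₁₂_zero` (n13-e's `hasSect2FormAE_zero_printedBackground` at the print's level-0 background).  The `T`-family faces
of §2∕§5 quantify over `∀ k, RTOpI (F.P P.K) k (SU N) (avOfRecord F N P.K k)`, a type the tree inhabits today only level-wise in the standing range `k < K`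
(`Node00.avOfRecord_haarAC`; located in `B14NodeKnitMachine`'s header) — dictionary lemmas; the closers are `T`-free (§3–§4, `…_of_laws_…` in §5).  One finite
four-torus programme at fixed `ε`, Bałaban AS PRINTED with locators; nothing continuum ∕ ℝ⁴ ∕ OS ∕ mass gap ∕ Clay.
-/

noncomputable section

open MeasureTheory
open scoped BigOperators Matrix.Norms.L2Operator

namespace Literature.MathematicalPhysics.QuantumFieldTheory.Balaban1983to89.B14NodeKnitRecord12R

open DagBinding T4DatumAssembly T4Continuum Node00
open B14NodeKnitTowerDatum (b14_main_at_datumOfTower_of_propTower densitiesDescribed_iff_core)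

variable (F : T4Family) (N : ℕ) [NeZero N]

/-! ## §1. The 𝐑-antecedent at Stage 12, PRINT-FAITHFUL: the leaf at the carriers of record, by name, and as [III]'s p. 244 sentence -/

section Leaf

variable (θ : Stage12Params F N) (w : WorldP) (P : B12.RunParams)

/-- **THE 𝐑-ANTECEDENT OF N11 AT A STAGE-12-BOUND RUN IS THE LEAF AT THE CARRIERS OF RECORD** (the junction Prop with N13, BY NAME): at `w.up P = upOfRecord₅C F N
(θ.toStage5₁₂ F N) P`, `(leavesP w P).rOperation ↔ ROpLeaf (VOfRecord₁₂ F N θ P)` — [Balaban1988Convergent] p. 244's assumed 𝐑 for the run, at the pinned 𝐑-carriers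
of the Stage-12 record (`Iff.rfl` behind the binding equation; nothing unfolded). [cite: Balaban1988Convergent, p.244 (bookkeeping: the leaf named)] -/
theorem rOperation_iff_rOpLeaf₁₂ (hup : w.up P = upOfRecord₅C F N (θ.toStage5₁₂ F N) P) :
    (leavesP w P).rOperation ↔ ROpLeaf (VOfRecord₁₂ F N θ P) := by
  show (w.up P).rOperation ↔ _
  rw [hup]
  exact Iff.rfl

/-- **THE LEAF AT THE STAGE-12 CARRIERS OF RECORD IS [III]'s TYPED p. 244 SENTENCE** (`B14.RAssumedP244`, verbatim there: *«we will only assume that it has some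
properties incorporated in the inductive description of the effective actions»* — `∀ k < K, ∀ ρ′, Scorr (k+1) ρ′ → S (k+1) (R k ρ′)`) for the density operation,
target space and corresponding space OF RECORD along the run `P` — the spaces now carrying the REPAIRED §2 format laws `SLaw₁₂` ∕ `TLaw₁₂` (`Iff.rfl`:
`DagBinding.ROpLeaf` is this by definition). [cite: Balaban1988Convergent, p.244] -/
theorem rOpLeaf₁₂_iff_rAssumedP244 :
    ROpLeaf (VOfRecord₁₂ F N θ P) ↔
      B14.RAssumedP244 (VOfRecord₁₂ F N θ P).R (VOfRecord₁₂ F N θ P).Scorr (VOfRecord₁₂ F N θ P).S P.K :=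
  Iff.rfl

/-- **THE PRODUCER'S SIDE OF THE JUNCTION, Stage 12** (node N13 = [Balaban1989LargeFieldII] Thm 1, `Dag.B16_main` :253, whose conclusion's first conjunct is
`ℓ.rOperation`): at a Stage-12-bound run, N13's node statement with its in-edge leaves `b5 b6 b7 b9 b10 b11 b13`, the basic step `rBasicStep`
([Balaban1989LargeFieldI]) and the small-field implication YIELDS the leaf at the carriers of record `ROpLeaf (VOfRecord₁₂ F N θ P)` — the Prop the seat
dag-n13-c lineage is asked to inhabit at Stage 12, BY NAME (A4 locator for N13's 𝐑-product in the print-faithful reading; the unfolded law-transport form is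
node00-def-T's `rOpLeaf_VOfRecord₁₂_iff`). [cite: Balaban1989LargeFieldII, Thm 1 p.355 (bookkeeping); Balaban1988Convergent, p.244] -/
theorem rOpLeaf₁₂_of_b16_main (hup : w.up P = upOfRecord₅C F N (θ.toStage5₁₂ F N) P) (hN : Dag.B16_main (leavesP w P))
    (h5 : (leavesP w P).b5) (h6 : (leavesP w P).b6) (h7 : (leavesP w P).b7) (h9 : (leavesP w P).b9) (h10 : (leavesP w P).b10)
    (h11 : (leavesP w P).b11) (h13 : (leavesP w P).b13) (hrb : (leavesP w P).rBasicStep)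
    (hsf : (leavesP w P).smallCouplings → (leavesP w P).smallFieldInductive) :
    ROpLeaf (VOfRecord₁₂ F N θ P) :=
  (rOperation_iff_rOpLeaf₁₂ F N θ w P hup).1 (hN h5 h6 h7 h9 h10 h11 h13 hrb hsf).1

end Leaf

/-! ## §2. [III]'s sentences READ AT THE STAGE-12 OBJECTS OF RECORD: the Theorem of p. 245 (sequence and space readings), the p. 244 assumption -/

section Sentences

variable (θ : Stage12Params F N) (w : WorldP) (P : B12.RunParams)

/-- **THE THEOREM OF p. 245, SEQUENCE READING, ALONG THE TRAJECTORY OF RECORD, Stage 12** ([Balaban1988Convergent] p. 245 [PDF 3], verbatim: *«Theorem. If ρ_k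
satisfies the assumptions described in detail in Sect. 2, then Tρ_k satisfies also the corresponding assumptions.»*): with `ρ_k := densOfRecord₁₀ … P k` in the
target space of record (`(VOfRecord₁₂ …).S k`) and `𝐓ρ_k :=` the 𝐓-image of record `tdensOfRecord₁₀ … P k` ((3.25) p. 270) tested in the corresponding space
(`(VOfRecord₁₂ …).Scorr (k+1)`), the sentence IS «repaired §2 form at `k` ⇒ repaired 𝐓-image form at `k`», `∀ k < K, SLaw₁₂ θ P k → TLaw₁₂ θ P k`.  Bookkeeping.
[cite: Balaban1988Convergent, Theorem p.245; (3.25) p.270] -/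
theorem thmP245_at_record₁₂_iff_laws :
    (∀ k, k < P.K → (VOfRecord₁₂ F N θ P).S k (densOfRecord₁₀ F N θ.toStage9Params P k) →
        (VOfRecord₁₂ F N θ P).Scorr (k + 1) (tdensOfRecord₁₀ F N θ.toStage9Params P k)) ↔
      ∀ k, k < P.K → SLaw₁₂ F N θ P k → TLaw₁₂ F N θ P k := by
  refine ⟨fun h k hk hS => ?_, fun h k hk hS => ?_⟩
  · have hT : tdensOfRecord₁₀ F N θ.toStage9Params P k = tdensOfRecord₁₀ F N θ.toStage9Params P k ∧ TLaw₁₂ F N θ P k :=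
      h k hk ⟨rfl, hS⟩
    exact hT.2
  · exact ⟨rfl, h k hk hS.2⟩

/-- **[III]'s OWN SLOT NAME AT THE STAGE-12 RECORD**: for ANY family `T` of renormalization transformations on the run's lattices (the cell's inhabited carrier
`Setup.RTOpI` along the averaging of record) that AGREES WITH THE TOWER ON THE TRAJECTORY (`(T k).T ρ_k = 𝐓ρ_k` of record, `k < K`), the typed Theorem of p. 245
`B14.ThmP245PrintedI T ρ S Scorr K` (sequence reading, [Balaban1988Convergent] p. 245 verbatim in `…B14`) at `ρ := densOfRecord₁₀ … P`, the Stage-12 spaces of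
record and `K := P.K` IS `∀ k < K, SLaw₁₂ θ P k → TLaw₁₂ θ P k`.  (The `RTOp`-form `B14.ThmP245Printed` :375 is the same Prop along `RTOp.toRTOpI`,
`B14.thmP245PrintedI_toRTOpI_iff`.)  A dictionary lemma; the closers of §3–§4 are `T`-free. [cite: Balaban1988Convergent, Theorem p.245] -/
theorem thmP245PrintedI_at_record₁₂_iff_laws (T : (k : ℕ) → RTOpI (F.P P.K) k (SU N) (avOfRecord F N P.K k))
    (hT : ∀ k, k < P.K → (T k).T (densOfRecord₁₀ F N θ.toStage9Params P k) = tdensOfRecord₁₀ F N θ.toStage9Params P k) :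
    B14.ThmP245PrintedI T (densOfRecord₁₀ F N θ.toStage9Params P) (VOfRecord₁₂ F N θ P).S (VOfRecord₁₂ F N θ P).Scorr P.K ↔
      ∀ k, k < P.K → SLaw₁₂ F N θ P k → TLaw₁₂ F N θ P k := by
  refine ⟨fun h k hk hS => ?_, fun h k hk hS => ?_⟩
  · have hT' : (T k).T (densOfRecord₁₀ F N θ.toStage9Params P k) = tdensOfRecord₁₀ F N θ.toStage9Params P k ∧ TLaw₁₂ F N θ P k :=
      h k hk ⟨rfl, hS⟩
    exact hT'.2
  · exact ⟨hT k hk, h k hk hS.2⟩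

/-- **THE SPACE READING OF THE THEOREM OF p. 245 AT THE STAGE-12 RECORD COINCIDES WITH THE SEQUENCE READING** ([Balaban1988Convergent] p. 262 [PDF 20], second
remark, verbatim: *«For a given index k we introduce the space of all densities satisfying the conditions of the inductive assumption. The theorem states that the
operation 𝐑T transforms the space with the index k into the space with the index k+1. This generalization does not seem to be useful, or interesting now.»* —
typed `B14.ThmP245SpacesI`): at the carriers of record the index-`k` space IS `{ρ : ρ = ρ_k ∧ SLaw₁₂ θ P k}` (the trajectory cut by the law), so for any `T`-family
agreeing with the tower on the trajectory the space reading IS `∀ k < K, SLaw₁₂ θ P k → TLaw₁₂ θ P k` — print's «not … useful» generalization is, at the objects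
of record, no generalization at all.  Dictionary lemma. [cite: Balaban1988Convergent, Theorem p.245 with remark p.262] -/
theorem thmP245SpacesI_at_record₁₂_iff_laws (T : (k : ℕ) → RTOpI (F.P P.K) k (SU N) (avOfRecord F N P.K k))
    (hT : ∀ k, k < P.K → (T k).T (densOfRecord₁₀ F N θ.toStage9Params P k) = tdensOfRecord₁₀ F N θ.toStage9Params P k) :
    B14.ThmP245SpacesI T (VOfRecord₁₂ F N θ P).S (VOfRecord₁₂ F N θ P).Scorr P.K ↔
      ∀ k, k < P.K → SLaw₁₂ F N θ P k → TLaw₁₂ F N θ P k := by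
  refine ⟨fun h => ?_, fun h k hk ρ hρ => ?_⟩
  · exact (thmP245PrintedI_at_record₁₂_iff_laws F N θ P T hT).1
      (B14.thmP245PrintedI_of_spacesI h (densOfRecord₁₀ F N θ.toStage9Params P))
  · obtain ⟨rfl, hS⟩ := hρ
    exact ⟨hT k hk, h k hk hS⟩

/-- **THE p. 244 ASSUMPTION AT THE STAGE-12 CARRIERS OF RECORD IS «𝐓-IMAGE FORM ⇒ §2 FORM ONE LEVEL UP»**: `B14.RAssumedP244` at `VOfRecord₁₂ θ P` ↔
`∀ k < K, TLaw₁₂ θ P k → SLaw₁₂ θ P (k+1)` — node00-def-T's `rOpLeaf_VOfRecord₁₂_iff`, quoted through §1 ([Balaban1988Convergent] Thm 2's statement shape at the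
objects of record; what [Balaban1989LargeFieldII] Thm 1 proves; at Stage 12 absent sequences pass on both sides).
[cite: Balaban1988Convergent, p.244 and Thm 2 p.263 (bookkeeping: the leaf unfolded, by name)] -/
theorem rAssumedP244_at_record₁₂_iff_laws :
    B14.RAssumedP244 (VOfRecord₁₂ F N θ P).R (VOfRecord₁₂ F N θ P).Scorr (VOfRecord₁₂ F N θ P).S P.K ↔
      ∀ k, k < P.K → TLaw₁₂ F N θ P k → SLaw₁₂ F N θ P (k + 1) :=
  (rOpLeaf₁₂_iff_rAssumedP244 F N θ P).symm.trans (rOpLeaf_VOfRecord₁₂_iff F N θ P)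

end Sentences

/-! ## §3. THEOREM 1 [III] AT THE STAGE-12 OBJECTS OF RECORD, RELATIVE TO 𝐑 — no world, no binding, NO START SLOT: `θ` and the run `P` only -/

section Thm1Relative

variable (θ : Stage12Params F N) (P : B12.RunParams)

/-- **THEOREM 1 [III] AT THE OBJECTS OF RECORD, RELATIVE TO 𝐑, THE START A THEOREM** ([Balaban1988Convergent] Thm 1 p. 262 [PDF 20], verbatim: *«… the sequence
of densities {ρ_k}, generated by successive applications of the operations 𝐑T to the density ρ₀ = exp[−(1∕g₀²)A − E], satisfies all the inductive
assumptions»*; its printed proof structure = the START + THE THEOREM OF p. 245 at every step + THE ASSUMED 𝐑 along (0.2), kernel-checked in `…B14` as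
`inductiveAssumptions_of_thmP245`; here the same induction RE-RUN AT THE STAGE-12 LAWS OF RECORD, whose base `SLaw₁₂ θ P 0` is node00-def-T's THEOREM
`sLaw₁₂_zero` — `ρ₀` of record HAS the §2 form at index 0 under the print's level-0 background `U₀(𝐖) = 𝐖 0`).  Hypotheses, both DISPLAYED and PRINTED: `hR` —
p. 244's assumption typed by [III]'s module, `B14.RAssumedP244`, at the 𝐑-carriers of record `VOfRecord₁₂ θ P` (= `ROpLeaf (VOfRecord₁₂ …)`, N13's product); `hT` —
the Theorem of p. 245 at the objects of record (§2): a repaired-§2-form `ρ_k` of record has its 𝐓-image of record in the corresponding space, `k < K`.  Conclusion: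
EVERY `ρ_k` of record, `k ≤ K`, has the repaired §2 [III] form of record.  Count-neutral; nothing of Sects. 1–3 asserted.
[cite: Balaban1988Convergent, Thm 1 p.262; Theorem p.245; p.244] -/
theorem sLaw₁₂_all_of_rAssumedP244
    (hR : B14.RAssumedP244 (VOfRecord₁₂ F N θ P).R (VOfRecord₁₂ F N θ P).Scorr (VOfRecord₁₂ F N θ P).S P.K)
    (hT : ∀ k, k < P.K → SLaw₁₂ F N θ P k → TLaw₁₂ F N θ P k) :
    ∀ k, k ≤ P.K → SLaw₁₂ F N θ P k := by
  have hR' : ∀ k, k < P.K → TLaw₁₂ F N θ P k → SLaw₁₂ F N θ P (k + 1) :=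
    (rAssumedP244_at_record₁₂_iff_laws F N θ P).1 hR
  intro k
  induction k with
  | zero => exact fun _ => sLaw₁₂_zero F N θ P
  | succ n ih =>
    intro hk
    exact hR' n (Nat.lt_of_succ_le hk) (hT n (Nat.lt_of_succ_le hk) (ih (Nat.le_of_succ_le hk)))

/-- **What Theorem 1 SAYS at Stage 12, relative to 𝐑**: under the two displayed hypotheses of `sLaw₁₂_all_of_rAssumedP244`, for every `k ≤ K` the post-𝐑 slot
family of `ρ_k` of record HAS THE REPAIRED §2 [III] FORM (a.e. reading `Node00.HasSect2FormAEZ`: localized terms `𝐄^{(i)}, 𝐑^{(i)}, 𝐁^{(i)}` obeying (2.27)–(2.28),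
(2.31), (2.41)–(2.42) on the spaces of record, universal 𝐄, and each slot absent or `slot_k(s) = 𝐓_k(s) exp A_k(s)` a.e. on the χ-support) AT THE 𝐓-WEIGHTS OF
RECORD OF THE RUN `WtOfRecord₁₂ θ P` and the repaired backgrounds `UbgOfRecord₁₂` — `Node00.sLaw₁₂_iff`. [cite: Balaban1988Convergent, Thm 1 p.262, (2.18) p.257, (2.23)–(2.42) pp.258–261] -/
theorem hasSect2FormAEZ_all_of_rAssumedP244
    (hR : B14.RAssumedP244 (VOfRecord₁₂ F N θ P).R (VOfRecord₁₂ F N θ P).Scorr (VOfRecord₁₂ F N θ P).S P.K)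
    (hT : ∀ k, k < P.K → SLaw₁₂ F N θ P k → TLaw₁₂ F N θ P k) (k : ℕ) (hk : k ≤ P.K) :
    HasSect2FormAEZ F N (FluctV N) P.K (settingOfRecord₁₂ F N θ P) (θ.Rz P.K) (WtOfRecord₁₂ F N θ P) k
      (UbgOfRecord₁₂ F N θ P k)
      (slotsOfRecord F N θ.ν θ.τ9 (EOfRecord₁₀ F N θ.toStage9Params) (wOfRecord₉ F N θ.toStage9Params) θ.ppSel P
        (gOfRecord₁₀ F N θ.toStage9Params P) k) :=
  (sLaw₁₂_iff F N θ P k).1 (sLaw₁₂_all_of_rAssumedP244 F N θ P hR hT k hk)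

variable (w : WorldP) (h : θ.Provisos₁₂ F N)

/-- **Theorem 1's conclusion `densitiesDescribed` AT A STAGE-12 WORLD, RELATIVE TO 𝐑** — with 𝐑 displayed as THE LEAF AT THE CARRIERS OF RECORD `ROpLeaf (VOfRecord₁₂
F N θ P)` (the Prop node N13 produces): at `w.C = (datumOfRecord₁₂ F N θ h).C`, the leaf + the Theorem of p. 245 at the objects of record give
`(leavesP w P).densitiesDescribed` — no start hypothesis (`sLaw₁₂_zero`). [cite: Balaban1988Convergent, Thm 1 p.262; Theorem p.245; p.244] -/
theorem densitiesDescribed_at_record₁₂_of_rOpLeaf (hC : w.C = (datumOfRecord₁₂ F N θ h).C) (hR : ROpLeaf (VOfRecord₁₂ F N θ P))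
    (hT : ∀ k, k < P.K → SLaw₁₂ F N θ P k → TLaw₁₂ F N θ P k) :
    (leavesP w P).densitiesDescribed :=
  (densitiesDescribed_iff_core F N (coreOfRecord₁₂ F N θ) (towerOfRecord₁₂ F N θ h) w P hC).2
    (sLaw₁₂_all_of_rAssumedP244 F N θ P ((rOpLeaf₁₂_iff_rAssumedP244 F N θ P).1 hR) hT)

end Thm1Relative

/-! ## §4. THE NODE at a Stage-12 world: 𝐑 consumed FROM N11's OWN ANTECEDENT through the leaf at the carriers of record; the N11∕N13 junction by name -/

section Node

variable (θ : Stage12Params F N) (h : θ.Provisos₁₂ F N) (w : WorldP) (P : B12.RunParams)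

/-- **N11 · `Dag.B14_main (leavesP w P)` AT A STAGE-12 WORLD, 𝐑 PRINT-FAITHFUL, ONE DISPLAYED SLOT** ([Balaban1988Convergent] Thm 1 p. 262 with the Theorem of
p. 245 and the assumed 𝐑 of p. 244, at NODE 00's Stage-12 objects of record).  Pins: `hC` the world is bound to the datum of record; (P1) `hV` the run's
`rOperation` antecedent names the leaf at the carriers of record `ROpLeaf (VOfRecord₁₂ F N θ P)` (at the C-binding of record: §1, `rOperation_iff_rOpLeaf₁₂`).
Slot, DISPLAYED and PRINTED: (S1ᵀ) `hT` — THE THEOREM OF p. 245 at the objects of record GIVEN the node's in-edges `b7 … b11` ([12] = B7, [14] = B8, [13] = B9,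
[16] = B10, [15] = B11), the interval hypothesis, the small-field inductive assumptions ([I], [II]) and the flow control (2.6): `∀ k < K, SLaw₁₂ … k → TLaw₁₂ … k`.
The START (S0) of the induction is node00-def-T's THEOREM `sLaw₁₂_zero` (no slot); the (𝐑) step is SUPPLIED BY THE NODE'S OWN ANTECEDENT read through the leaf
(p. 244's sentence at the carriers of record, `rOpLeaf_VOfRecord₁₂_iff`) — load-bearing, not discarded, not a hypothesis of this theorem.  Composition:
`B14NodeKnitTowerDatum.b14_main_at_datumOfTower_of_propTower` at `InS := SLaw₁₂ θ P`, `InT := TLaw₁₂ θ P` (the datum of record IS `datumOfTower F N (coreOfRecord₁₂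
…) (towerOfRecord₁₂ …)`, `rfl`; the core's clause IS `SLaw₁₂`, `sect2Form_coreOfRecord₁₂_iff`).  Count-neutral slot landing.
[cite: Balaban1988Convergent, Thm 1 p.262; Theorem p.245; p.244] -/
theorem b14_main_at_record₁₂_of_rOpLeaf (hC : w.C = (datumOfRecord₁₂ F N θ h).C)
    (hV : (leavesP w P).rOperation → ROpLeaf (VOfRecord₁₂ F N θ P))
    (hT : (leavesP w P).b7 → (leavesP w P).b8 → (leavesP w P).b9 → (leavesP w P).b10 → (leavesP w P).b11 →
      (leavesP w P).smallCouplings → (leavesP w P).smallFieldInductive → (leavesP w P).flowControl →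
        ∀ k, k < P.K → SLaw₁₂ F N θ P k → TLaw₁₂ F N θ P k) :
    Dag.B14_main (leavesP w P) :=
  b14_main_at_datumOfTower_of_propTower F N (coreOfRecord₁₂ F N θ) (towerOfRecord₁₂ F N θ h) w P hC
    (SLaw₁₂ F N θ P) (TLaw₁₂ F N θ P) (fun _ _ hS => hS) (fun _ => sLaw₁₂_zero F N θ P) hT
    (fun hrop => (rOpLeaf_VOfRecord₁₂_iff F N θ P).1 (hV hrop))

/-- **What N11 SAYS at Stage 12, the 𝐑-antecedent AS PRINT ASSUMES IT** (A4 locator, vacuity audit in kernel form): N11 at a world bound to the datum of record,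
GIVEN its in-edge leaves, the small-field implication, the located flow step, the interval hypothesis, the reading (P1) `hV` AND THE LEAF AT THE CARRIERS OF RECORD
`ROpLeaf (VOfRecord₁₂ F N θ P)` — node N13's product, by name — YIELDS the repaired §2 [III] form of every `ρ_k` of record, `∀ k ≤ K, SLaw₁₂ θ P k` (not closable by
a trivially true format: `SLaw₁₂` is `HasSect2FormAEZ` of the slot family of record at the pinned 𝐓-weights; at `k = 0` a theorem, at `k ≥ 1` the content).  The
law-transport reading of the same locator is seat dag-n11-d's `BalabanUVNodesN11AtRecord12C.sLaw₁₂_all_of_b14_main` (Summits side).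
[cite: Balaban1988Convergent, Thm 1 p.262 (bookkeeping); p.244] -/
theorem sLaw₁₂_all_of_b14_main_of_rOpLeaf (hC : w.C = (datumOfRecord₁₂ F N θ h).C) (hV : ROpLeaf (VOfRecord₁₂ F N θ P) → (leavesP w P).rOperation)
    (hN : Dag.B14_main (leavesP w P))
    (h7 : (leavesP w P).b7) (h8 : (leavesP w P).b8) (h9 : (leavesP w P).b9) (h10 : (leavesP w P).b10) (h11 : (leavesP w P).b11)
    (hsf : (leavesP w P).smallCouplings → (leavesP w P).smallFieldInductive)
    (hfc : (leavesP w P).smallCouplings → (leavesP w P).flowControl)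
    (hR : ROpLeaf (VOfRecord₁₂ F N θ P)) (hsc : (leavesP w P).smallCouplings) :
    ∀ k, k ≤ P.K → SLaw₁₂ F N θ P k :=
  (densitiesDescribed_iff_core F N (coreOfRecord₁₂ F N θ) (towerOfRecord₁₂ F N θ h) w P hC).1 (hN h7 h8 h9 h10 h11 hsf hfc (hV hR) hsc)

/-- **THEOREM 1 [III] AT A STAGE-12-BOUND RUN FROM THE TWO NODES' PRINTED PRODUCTS, the junction BY NAME** (how `Dag.uv_stability_of_series` hands N13's product to
N11, read at the objects of record): at a run bound by `w.up P = upOfRecord₅C F N (θ.toStage5₁₂ F N) P` (no construction clause, no provisos needed), GIVEN node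
N13's statement `Dag.B16_main (leavesP w P)` with ITS in-edge leaves `b5 b6 b7 b9 b10 b11 b13` and `rBasicStep` ([Balaban1989LargeFieldI]; N12's product) — which
YIELDS the leaf `ROpLeaf (VOfRecord₁₂ F N θ P)` (§1) —, N11's ONE slot (S1ᵀ) at the objects of record and N11's remaining antecedents `b8`, the small-field
implication and the located flow step: under the interval hypothesis EVERY `ρ_k` of record, `k ≤ K`, has the repaired §2 [III] form of record.  Pure composition
(the start being `sLaw₁₂_zero`); both nodes' analytic contents stay displayed. [cite: Balaban1988Convergent, Thm 1 p.262; Theorem p.245; p.244; Balaban1989LargeFieldII, Thm 1 p.355] -/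
theorem sLaw₁₂_all_of_b16_main_of_slots (hup : w.up P = upOfRecord₅C F N (θ.toStage5₁₂ F N) P)
    (hN13 : Dag.B16_main (leavesP w P))
    (h5 : (leavesP w P).b5) (h6 : (leavesP w P).b6) (h7 : (leavesP w P).b7) (h8 : (leavesP w P).b8) (h9 : (leavesP w P).b9)
    (h10 : (leavesP w P).b10) (h11 : (leavesP w P).b11) (h13 : (leavesP w P).b13) (hrb : (leavesP w P).rBasicStep)
    (hsf : (leavesP w P).smallCouplings → (leavesP w P).smallFieldInductive)
    (hfc : (leavesP w P).smallCouplings → (leavesP w P).flowControl)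
    (hT : (leavesP w P).b7 → (leavesP w P).b8 → (leavesP w P).b9 → (leavesP w P).b10 → (leavesP w P).b11 →
      (leavesP w P).smallCouplings → (leavesP w P).smallFieldInductive → (leavesP w P).flowControl →
        ∀ k, k < P.K → SLaw₁₂ F N θ P k → TLaw₁₂ F N θ P k)
    (hsc : (leavesP w P).smallCouplings) : ∀ k, k ≤ P.K → SLaw₁₂ F N θ P k :=
  have hR : ROpLeaf (VOfRecord₁₂ F N θ P) := rOpLeaf₁₂_of_b16_main F N θ w P hup hN13 h5 h6 h7 h9 h10 h11 h13 hrb hsf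
  sLaw₁₂_all_of_rAssumedP244 F N θ P ((rOpLeaf₁₂_iff_rAssumedP244 F N θ P).1 hR) (hT h7 h8 h9 h10 h11 hsc (hsf hsc) (hfc hsc))

end Node

/-! ## §5. [V]∕[III] THEOREM 1 AS THE TREE STATES IT (`B16.Thm1Printed` at the datum of record) FROM [III]'s TWO SENTENCES IN [III]'s CURRENCY -/

section Thm1Printed

variable (θ : Stage12Params F N) (h : θ.Provisos₁₂ F N)

/-- **`B16.Thm1Printed (datumOfRecord₁₂ F N θ h).C` FROM THE THEOREM OF p. 245 AND THE p. 244 ASSUMPTION AT THE OBJECTS OF RECORD, law currency, `T`-free**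
(the route's (B)-face first conjunct, [Balaban1989LargeFieldII] Thm 1 p. 355 = [Balaban1988Convergent] Thm 1 p. 262 as the tree states it over the datum's `Sect2Data`):
along every run whose flow stays in a window `]0, γ]` (`0 < γ`), the Theorem of p. 245 at the objects of record (`hT`, N11's product) and `B14.RAssumedP244` at the
Stage-12 carriers of record (`hR`, N13's product AS [III] ASSUMES IT) give Theorem 1 at the datum — node00-def-T's `thm1Printed_datumOfRecord₁₂_of_tLaw_rOpLeaf`
(base `inductionBase_datumOfRecord₁₂`, a theorem; step from the two laws) read through §1.  Both hypotheses displayed; nothing of Sects. 1–3 ∕ [IV] asserted.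
[cite: Balaban1988Convergent, Thm 1 p.262; Theorem p.245; p.244; Balaban1989LargeFieldII, Thm 1 p.355 + p.391] -/
theorem thm1Printed_datumOfRecord₁₂_of_laws_rAssumedP244 {γ : ℝ} (hγ : 0 < γ)
    (hT : ∀ P : B12.RunParams, ((datumOfRecord₁₂ F N θ h).C P).flow.InInterval γ P.K →
      ∀ k, k < P.K → SLaw₁₂ F N θ P k → TLaw₁₂ F N θ P k)
    (hR : ∀ P : B12.RunParams, ((datumOfRecord₁₂ F N θ h).C P).flow.InInterval γ P.K →
      B14.RAssumedP244 (VOfRecord₁₂ F N θ P).R (VOfRecord₁₂ F N θ P).Scorr (VOfRecord₁₂ F N θ P).S P.K) :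
    B16.Thm1Printed (datumOfRecord₁₂ F N θ h).C :=
  thm1Printed_datumOfRecord₁₂_of_tLaw_rOpLeaf F N θ h hγ hT
    (fun P hP => (rOpLeaf₁₂_iff_rAssumedP244 F N θ P).2 (hR P hP))

/-- **`B16.Thm1Printed` AT THE STAGE-12 DATUM FROM [III]'s TWO SENTENCES IN [III]'s OWN NAMES** — `B14.ThmP245PrintedI` (the Theorem of p. 245, sequence reading,
for any `T`-family agreeing with the tower on the trajectory of each windowed run) and `B14.RAssumedP244` (p. 244) at the Stage-12 carriers of record: the
director's row «`ThmP245Printed` via `rOperation` from N13's `ROpLeaf`» composed to the (B)-face's first conjunct, by name (§2's dictionary into the `T`-free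
closer).  Dictionary-level: the `T`-family binder ranges over the cell's `RTOpI` carrier (see the header's HONEST FRAMING); the load-bearing content is `hT`'s law
reading and `hR`. [cite: Balaban1988Convergent, Thm 1 p.262; Theorem p.245; p.244; Balaban1989LargeFieldII, Thm 1 p.355] -/
theorem thm1Printed_datumOfRecord₁₂_of_thmP245I_rAssumedP244 {γ : ℝ} (hγ : 0 < γ)
    (T : (P : B12.RunParams) → (k : ℕ) → RTOpI (F.P P.K) k (SU N) (avOfRecord F N P.K k))
    (hTT : ∀ (P : B12.RunParams) (k : ℕ), k < P.K →
      (T P k).T (densOfRecord₁₀ F N θ.toStage9Params P k) = tdensOfRecord₁₀ F N θ.toStage9Params P k)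
    (hT : ∀ P : B12.RunParams, ((datumOfRecord₁₂ F N θ h).C P).flow.InInterval γ P.K →
      B14.ThmP245PrintedI (T P) (densOfRecord₁₀ F N θ.toStage9Params P) (VOfRecord₁₂ F N θ P).S (VOfRecord₁₂ F N θ P).Scorr P.K)
    (hR : ∀ P : B12.RunParams, ((datumOfRecord₁₂ F N θ h).C P).flow.InInterval γ P.K →
      B14.RAssumedP244 (VOfRecord₁₂ F N θ P).R (VOfRecord₁₂ F N θ P).Scorr (VOfRecord₁₂ F N θ P).S P.K) :
    B16.Thm1Printed (datumOfRecord₁₂ F N θ h).C :=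
  thm1Printed_datumOfRecord₁₂_of_laws_rAssumedP244 F N θ h hγ
    (fun P hP => (thmP245PrintedI_at_record₁₂_iff_laws F N θ P (T P) (hTT P)).1 (hT P hP)) hR

end Thm1Printed

/-! ## §6. KEYED on the (D, w)-interface `IsRecordOfRecord₁₂C`: Theorem 1's conclusion at every run, relative to the world's OWN 𝐑-leaves -/

section Keyed

variable {F N}
variable {D : FiniteEpsData F (SU N)} {w : WorldP}

/-- **THEOREM 1's CONCLUSION AT EVERY RUN OF A STAGE-12 RECORD, RELATIVE TO 𝐑 AND THE THEOREM OF p. 245** (the (D, w)-face of §3 for consumers that see only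
the record predicate, e.g. the route's glue): a Stage-12 record `(D, w)` PRESENTS parameters `θ` with their provisos and `D = datumOfRecord₁₂ θ hP`, and at every
run `P` the world's own 𝐑-antecedent `(leavesP w P).rOperation` (node N13's product; by the C-binding of record it IS the leaf `ROpLeaf (VOfRecord₁₂ θ P)`, §1)
together with the Theorem of p. 245 at the presenting objects of record (`∀ k < K, SLaw₁₂ θ P k → TLaw₁₂ θ P k`, node N11's product, displayed) gives N11's
conclusion leaf `(leavesP w P).densitiesDescribed` — no start slot.  (The law-level (B)-face twin `B16.Thm1Printed D.C` under a window is node00-def-T's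
`thm1Printed_of_isRecordOfRecord₁₂C_of_tLaw`; the keyed NODE statement is seat dag-n11-d's `b14_main_of_isRecordOfRecord₁₂C`.)
[cite: Balaban1988Convergent, Thm 1 p.262; Theorem p.245; p.244; Balaban1989LargeFieldII, Thm 1 p.355 (bookkeeping)] -/
theorem densitiesDescribed_of_isRecordOfRecord₁₂C_of_rOperation (hrec : IsRecordOfRecord₁₂C F N D w) :
    ∃ (θ : Stage12Params F N) (hP : θ.Provisos₁₂ F N), θ.Admissible F N ∧ D = datumOfRecord₁₂ F N θ hP ∧
      ∀ P : B12.RunParams, (leavesP w P).rOperation → (∀ k, k < P.K → SLaw₁₂ F N θ P k → TLaw₁₂ F N θ P k) →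
        (leavesP w P).densitiesDescribed := by
  obtain ⟨θ, hP, hθ, hD, hC, -, -, hup⟩ := hrec
  refine ⟨θ, hP, hθ, hD, fun P hrop hT => ?_⟩
  exact densitiesDescribed_at_record₁₂_of_rOpLeaf F N θ P w hP (by rw [hC, hD])
    ((rOperation_iff_rOpLeaf₁₂ F N θ w P (hup P)).1 hrop) hT

end Keyed

end Literature.MathematicalPhysics.QuantumFieldTheory.Balaban1983to89.B14NodeKnitRecord12R

end
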